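import Summits.Parity.GeneralizedHardyLittlewood.Theorems.PrimeLevelFamEdgeMomentsBeyondDiagonalFirstOrderAFE
import Summits.Parity.GeneralizedHardyLittlewood.Theorems.PrimeLevelFamEdgeMomentsBeyondDiagonalDictionaryAtOne
import Literature.NumberTheory.LFunctions.Bettin2017PrimeLevelFricke
import HarnessLib

/-!
# Route `PrimeLevelFamEdge`, crux K_A `MomentsBeyondDiagonal` (stmt-Parity-20007), line «petersson_layers» v4:
# THE FIRST-MOMENT DICTIONARY AT EVERY ORDER — `Σʰ Λ^{(k)}(f,½) M_P(f)` as an explicit series against the harmonic PAIR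
# average, sign term included (`q` prime, weight 2; helper for `stub_first : SubFirst` at every `Q`)

With the exact first-moment AFE at order `k` (`…FirstOrderAFE`, p796317) and the prime-level Fricke–Hecke relation
`η_f λ_f(n) = −q^{1/2} λ_f(qn)` (`Bettin2017.frickeEigenvalue_mul_heckeLambda`), for `q` prime:
* §1 `LhPQ_eq_sum_orders`: `L^h(P,Q)(M) = Σ_{j ≤ deg Q} Q_j ℓ^{−j} Σʰ Λ^{(j)}(f,½) M_P(f)` (linearity; every `q`);
* §2 `hasSum_firstAFE_of_mem_newforms0`: the order-`k` AFE series of a newform converges (export of the HasSum);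
* §3 `harmonicSum_derivLambda_mul_mollifier_eq_tsum_pet`:
  `Σʰ Λ^{(k)}(f,½) M_P(f) = q̂^{1/2} Σ'_n n^{−1/2} V_k(q̂;n) Σ_{m ≤ M} x_m [Σʰ λ_f(n)λ_f(m) + (−1)^k q^{1/2} Σʰ λ_f(qn)λ_f(m)]`,
  `V_k(q̂;n) = ∫_{n/q̂}^∞ e^{−x}(log(q̂/n)+log x)^k dx` — the de-automorphisation of the first moment at every order: the
  first bracket is Petersson's `δ(n,m) − J(n,m)`, the second (`m ≤ M < q ≤ qn`, so no diagonal) is `−J(qn,m)`, the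
  Bettin-range content beyond the diagonal.
Remaining for `stub_first` ∀`Q` (not done here): the asymptotic evaluation of the diagonal `q̂^{1/2} Σ_m x_m m^{−1/2} V_k(q̂;m)`
(KMV §4.1 (19)–(20) at order `k`) and bounds for the two `J`-parts on `1 < Δ' < Δ`. Proof only; K_A NOT proved.
-/

noncomputable section

open scoped Real
open Complex Finset Polynomial CongruenceSubgroup MeasureTheory Set
open Literature.NumberTheory.EllipticCurves.ModularForms
open Literature.NumberTheory.LFunctions Literature.NumberTheory.LFunctions.KMV2000

namespace Summit.Parity.GeneralizedHardyLittlewood.Theorems.MomentsBeyondDiagonal.FirstOrderAFE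

open Summit.Parity.GeneralizedHardyLittlewood.Theorems.PrimeLevelFamEdgeIdeaDeltas.PeterssonLayers
  (harmonicSum_congr_newforms harmonicSum_finset_sum)

/-! ## §1. `L^h(P,Q)` in orders -/

/-- **§1.** `L^h(P,Q)(M) = Σ_{j ∈ [0, deg Q]} Q_j (log q̂)^{−j} Σʰ_f Λ^{(j)}(f,½) M_P(f)` (definition of `KMV2000.Qtilde`, linearity
of `Σʰ`). [cite: KowalskiMichelVanderKam2000, §6 p. 19 (definition of Q̃ and L^h(P,Q))] -/
theorem LhPQ_eq_sum_orders (q : ℕ) [NeZero q] (P Q : ℝ[X]) (M : ℝ) :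
    LhPQ q P Q M = ∑ j ∈ Finset.range (Q.natDegree + 1),
      (Q.coeff j : ℂ) * (((Real.log (qhat q))⁻¹ : ℝ) : ℂ) ^ j *
        GL2Family.harmonicSum q 2 (fun f ↦ derivLambda q j f * mollifierP q P M f) := by
  unfold LhPQ
  have h : ∀ f : CuspForm (Gamma0 q) 2, Qtilde q Q f * mollifierP q P M f =
      ∑ j ∈ Finset.range (Q.natDegree + 1), (Q.coeff j : ℂ) * (((Real.log (qhat q))⁻¹ : ℝ) : ℂ) ^ j *
        (derivLambda q j f * mollifierP q P M f) := by
    intro f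
    rw [Qtilde, Finset.sum_mul]
    refine Finset.sum_congr rfl fun j _ ↦ ?_
    ring
  simp_rw [h]
  rw [harmonicSum_finset_sum]
  refine Finset.sum_congr rfl fun j _ ↦ ?_
  rw [GL2Family.harmonicSum_const_mul]

/-! ## §2. The order-`k` AFE series of a newform converges -/

variable {N : ℕ} [NeZero N]

/-- **§2.** For a newform `f` of level `N` and every `k`, the series `Σ_n λ_f(n) n^{−1/2} V_k(q̂;n)` converges, with sum
`2π ∫_{1/√N}^∞ f(iy)(log √N y)^k dy`. [cite: KowalskiMichelVanderKam2000, (13)–(14) p. 9] -/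
theorem hasSum_firstAFE (f : CuspForm (Gamma0 N) 2) (k : ℕ) :
    HasSum (fun n : ℕ ↦ GL2Family.heckeLambda f n * (((n : ℝ) ^ (-(1 / 2 : ℝ)) : ℝ) : ℂ) *
        ((∫ x in Ioi ((n : ℝ) / qhat N), Real.exp (-x) * (Real.log (qhat N / n) + Real.log x) ^ k : ℝ) : ℂ))
      (2 * (π : ℂ) * ∫ v in Ioi ((Real.sqrt N)⁻¹ : ℝ), f (UpperHalfPlane.ofComplex (Complex.I * v)) *
        (((Real.log (Real.sqrt N * v)) ^ k : ℝ) : ℂ)) := by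
  have hb : 0 < ((Real.sqrt N)⁻¹ : ℝ) := inv_pos.mpr (Real.sqrt_pos.mpr (by exact_mod_cast NeZero.pos N))
  have hS := hasSum_integral_Ioi_imagAxis_logWeight f k hb
  have hterm : ∀ n : ℕ, 2 * (π : ℂ) * (cuspCoeff f n *
      ((∫ v in Ioi ((Real.sqrt N)⁻¹ : ℝ), Real.exp (-(2 * Real.pi * n) * v) * (Real.log (Real.sqrt N * v)) ^ k : ℝ) : ℂ)) =
      GL2Family.heckeLambda f n * (((n : ℝ) ^ (-(1 / 2 : ℝ)) : ℝ) : ℂ) *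
        ((∫ x in Ioi ((n : ℝ) / qhat N), Real.exp (-x) * (Real.log (qhat N / n) + Real.log x) ^ k : ℝ) : ℂ) := by
    intro n
    rcases Nat.eq_zero_or_pos n with rfl | hn
    · simp [cuspCoeff_zero one_mem_strictPeriods_Gamma0 f, heckeLambda_zero]
    have hn0 : (0 : ℝ) < n := by exact_mod_cast hn
    rw [integral_Ioi_exp_comp_logWeight hn.ne' hb (fun u ↦ u ^ k), two_pi_mul_div_sqrt,
      Bettin2017.heckeLambda_weight_two]
    have hpow : (((n : ℝ) ^ (-(1 / 2 : ℝ)) : ℝ) : ℂ) * (((n : ℝ) ^ (-(1 / 2 : ℝ)) : ℝ) : ℂ) = ((n : ℂ))⁻¹ := by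
      rw [← Complex.ofReal_mul, ← Real.rpow_add hn0, show (-(1 / 2 : ℝ)) + -(1 / 2) = -1 by norm_num,
        Real.rpow_neg_one]
      push_cast
      rfl
    have hπ : (π : ℂ) ≠ 0 := by exact_mod_cast Real.pi_pos.ne'
    have hnC : (n : ℂ) ≠ 0 := by exact_mod_cast hn.ne'
    set I : ℂ := ((∫ x in Ioi ((n : ℝ) / qhat N), Real.exp (-x) * (Real.log (qhat N / n) + Real.log x) ^ k : ℝ) : ℂ)
      with hI
    push_cast
    calc 2 * (π : ℂ) * (cuspCoeff f n * ((2 * (π : ℂ) * n)⁻¹ * I)) = cuspCoeff f n * ((n : ℂ))⁻¹ * I := by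
          field_simp
      _ = _ := by rw [← hpow]; ring
  have h2 := hS.mul_left (2 * (π : ℂ))
  have hfun : (fun n : ℕ ↦ 2 * (π : ℂ) * (cuspCoeff f n *
      ((∫ v in Ioi ((Real.sqrt N)⁻¹ : ℝ), Real.exp (-(2 * Real.pi * n) * v) * (Real.log (Real.sqrt N * v)) ^ k : ℝ) : ℂ))) =
      fun n : ℕ ↦ GL2Family.heckeLambda f n * (((n : ℝ) ^ (-(1 / 2 : ℝ)) : ℝ) : ℂ) *
        ((∫ x in Ioi ((n : ℝ) / qhat N), Real.exp (-x) * (Real.log (qhat N / n) + Real.log x) ^ k : ℝ) : ℂ) :=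
    funext hterm
  rw [hfun] at h2
  exact h2

/-! ## §3. The first-moment dictionary at order `k` (`q` prime) -/

/-- Per form, `q` prime: `(1 − (−1)^k η_f) λ_f(n) = λ_f(n) + (−1)^k q^{1/2} λ_f(qn)` (`η_f λ_f(n) = −q^{1/2}λ_f(qn)`).
[cite: KowalskiMichel2000, §2.4.2 p. 312] -/
theorem sign_mul_heckeLambda {q : ℕ} [NeZero q] (hq : q.Prime) {f : CuspForm (Gamma0 q) 2} (hf : f ∈ newforms0 q 2)
    (k n : ℕ) :
    (1 - (-1 : ℂ) ^ k * frickeEigenvalue f) * GL2Family.heckeLambda f n =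
      GL2Family.heckeLambda f n + (-1 : ℂ) ^ k * (q : ℂ) ^ (1 / 2 : ℂ) * GL2Family.heckeLambda f (q * n) := by
  have h := Bettin2017.frickeEigenvalue_mul_heckeLambda hq (show IsNewform0 f from hf) n
  linear_combination (-((-1 : ℂ) ^ k)) * h

/-- **§3. THE FIRST-MOMENT DICTIONARY AT ORDER `k`** (`q` prime, any real `P`, any `M`):
`Σʰ Λ^{(k)}(f,½) M_P(f) = q̂^{1/2} Σ'_n n^{−1/2} V_k(q̂;n) Σ_{m ≤ M} x_m [Σʰλ_f(n)λ_f(m) + (−1)^k q^{1/2} Σʰλ_f(qn)λ_f(m)]`.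
[cite: KowalskiMichelVanderKam2000, §4 (14), (16) p. 9–11] -/
theorem harmonicSum_derivLambda_mul_mollifier_eq_tsum_pet {q : ℕ} [NeZero q] (hq : q.Prime) (P : ℝ[X]) (M : ℝ)
    (k : ℕ) :
    GL2Family.harmonicSum q 2 (fun f ↦ derivLambda q k f * mollifierP q P M f) =
      ((qhat q : ℝ) : ℂ) ^ (1 / 2 : ℂ) *
        ∑' n : ℕ, (((n : ℝ) ^ (-(1 / 2 : ℝ)) : ℝ) : ℂ) *
          ((∫ x in Ioi ((n : ℝ) / qhat q), Real.exp (-x) * (Real.log (qhat q / n) + Real.log x) ^ k : ℝ) : ℂ) *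
          ∑ m ∈ Icc 1 ⌊M⌋₊, (mollifierCoeff P M m : ℂ) *
            (KowalskiMichel2000.pet q n m + (-1 : ℂ) ^ k * (q : ℂ) ^ (1 / 2 : ℂ) * KowalskiMichel2000.pet q (q * n) m) := by
  have hfin := finite_newforms0_holds q 2
  -- abbreviations
  set c : ℕ → ℂ := fun n ↦ (((n : ℝ) ^ (-(1 / 2 : ℝ)) : ℝ) : ℂ) *
    ((∫ x in Ioi ((n : ℝ) / qhat q), Real.exp (-x) * (Real.log (qhat q / n) + Real.log x) ^ k : ℝ) : ℂ) with hc
  set s : ℂ := ((qhat q : ℝ) : ℂ) ^ (1 / 2 : ℂ) with hs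
  -- per form: the order-k AFE times `M_P(f)`, as a series in `n` (weights inside)
  have hform : ∀ f ∈ hfin.toFinset,
      HasSum (fun n : ℕ ↦ (GL2Family.harmonicWeight f : ℂ) * (s * (c n *
          ((GL2Family.heckeLambda f n + (-1 : ℂ) ^ k * (q : ℂ) ^ (1 / 2 : ℂ) * GL2Family.heckeLambda f (q * n)) *
            mollifierP q P M f))))
        ((GL2Family.harmonicWeight f : ℂ) * (derivLambda q k f * mollifierP q P M f)) := by
    intro f hf
    have hf' : f ∈ newforms0 q 2 := (Set.Finite.mem_toFinset hfin).mp hf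
    have hA := hasSum_firstAFE f k
    have hΛ := derivLambda_eq_tsum_firstAFE_of_mem_newforms0 f hf' k
    -- `Λ^{(k)} M_P = Σ_n s (1 - (-1)^k η) (λ n^{-1/2} V) M_P`
    have h1 := (hA.mul_left (s * (1 - (-1 : ℂ) ^ k * frickeEigenvalue f))).mul_right (mollifierP q P M f)
    have hval : s * (1 - (-1 : ℂ) ^ k * frickeEigenvalue f) *
        (2 * (π : ℂ) * ∫ v in Ioi ((Real.sqrt q)⁻¹ : ℝ), f (UpperHalfPlane.ofComplex (Complex.I * v)) *
          (((Real.log (Real.sqrt q * v)) ^ k : ℝ) : ℂ)) * mollifierP q P M f =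
        derivLambda q k f * mollifierP q P M f := by
      rw [hΛ, hA.tsum_eq]
    rw [hval] at h1
    have h2 := h1.mul_left (GL2Family.harmonicWeight f : ℂ)
    refine h2.congr_fun fun n ↦ ?_
    have hsg := sign_mul_heckeLambda hq hf' k n
    simp only [hc]
    rw [← hsg]
    ring
  -- sum over the (finitely many) newforms and exchange with the series
  unfold GL2Family.harmonicSum
  rw [finsum_mem_eq_finite_toFinset_sum _ hfin]
  have hsumeq : ∑ f ∈ hfin.toFinset, (GL2Family.harmonicWeight f : ℂ) * (derivLambda q k f * mollifierP q P M f) =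
      ∑ f ∈ hfin.toFinset, ∑' n : ℕ, (GL2Family.harmonicWeight f : ℂ) * (s * (c n *
          ((GL2Family.heckeLambda f n + (-1 : ℂ) ^ k * (q : ℂ) ^ (1 / 2 : ℂ) * GL2Family.heckeLambda f (q * n)) *
            mollifierP q P M f))) :=
    Finset.sum_congr rfl fun f hf ↦ ((hform f hf).tsum_eq).symm
  rw [hsumeq, ← Summable.tsum_finsetSum (fun f hf ↦ (hform f hf).summable), ← tsum_mul_left]
  refine tsum_congr fun n ↦ ?_
  -- the slice at `n`: open `M_P(f)` and fold the harmonic averages into `pet`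
  have hslice : ∑ f ∈ hfin.toFinset, (GL2Family.harmonicWeight f : ℂ) * (s * (c n *
          ((GL2Family.heckeLambda f n + (-1 : ℂ) ^ k * (q : ℂ) ^ (1 / 2 : ℂ) * GL2Family.heckeLambda f (q * n)) *
            mollifierP q P M f))) =
      s * (c n * GL2Family.harmonicSum q 2 (fun f ↦
          (GL2Family.heckeLambda f n + (-1 : ℂ) ^ k * (q : ℂ) ^ (1 / 2 : ℂ) * GL2Family.heckeLambda f (q * n)) *
            mollifierP q P M f)) := by
    unfold GL2Family.harmonicSum
    rw [finsum_mem_eq_finite_toFinset_sum _ hfin, Finset.mul_sum, Finset.mul_sum]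
    refine Finset.sum_congr rfl fun f _ ↦ ?_
    ring
  rw [hslice]
  have hopen : ∀ f : CuspForm (Gamma0 q) 2,
      (GL2Family.heckeLambda f n + (-1 : ℂ) ^ k * (q : ℂ) ^ (1 / 2 : ℂ) * GL2Family.heckeLambda f (q * n)) *
          mollifierP q P M f =
        ∑ m ∈ Icc 1 ⌊M⌋₊, (mollifierCoeff P M m : ℂ) *
          (GL2Family.heckeLambda f n * GL2Family.heckeLambda f m +
            (-1 : ℂ) ^ k * (q : ℂ) ^ (1 / 2 : ℂ) * (GL2Family.heckeLambda f (q * n) * GL2Family.heckeLambda f m)) := by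
    intro f
    rw [mollifierP_eq_sum_mollifierCoeff, Finset.mul_sum]
    refine Finset.sum_congr rfl fun m _ ↦ ?_
    ring
  simp_rw [hopen]
  rw [harmonicSum_finset_sum]
  congr 1
  rw [hc]
  congr 1
  refine Finset.sum_congr rfl fun m _ ↦ ?_
  rw [GL2Family.harmonicSum_const_mul]
  congr 1
  unfold KowalskiMichel2000.pet GL2Family.harmonicSum
  rw [finsum_mem_eq_finite_toFinset_sum _ hfin, finsum_mem_eq_finite_toFinset_sum _ hfin,
    finsum_mem_eq_finite_toFinset_sum _ hfin, Finset.mul_sum, ← Finset.sum_add_distrib]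
  refine Finset.sum_congr rfl fun f _ ↦ ?_
  ring

end Summit.Parity.GeneralizedHardyLittlewood.Theorems.MomentsBeyondDiagonal.FirstOrderAFE

end
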